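/-
Copyright: lit-balaban cell, Phase-2 proof seat p33 (gen 6).  Statement-level skeleton of a published paper; no proof claims beyond
what the kernel checks below.
-/
import Literature.MathematicalPhysics.QuantumFieldTheory.BalabanImbrieJaffe1984to88.BIJ85Ineq732Flat
import Literature.MathematicalPhysics.QuantumFieldTheory.BalabanImbrieJaffe1984to88.BIJ85BlockAveragingIneqCov
import Literature.MathematicalPhysics.QuantumFieldTheory.BalabanImbrieJaffe1984to88.BIJ85Eq453GaugeField

/-!
# `BalabanImbrieJaffe1984to88.BIJ85Ineq732PullBack` — T. Bałaban, J. Imbrie, A. Jaffe, *Renormalization of the Higgs model: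
minimizers, propagators and the stability of mean field theory*, Commun. Math. Phys. **97** (1985) 299–329
[BalabanImbrieJaffe1985]: Sect. 7.3 p. 326, **the scalar stability estimate (7.3.2) PROVED, WITH NO NEGATIVE MASS TERM (`M = 0`),
AT THE PULL-BACK BACKGROUND `u = Q^{s*}_k v` OF (4.5.2)/(4.5.3) FOR EVERY UNIT-LATTICE `U(1)` FIELD `v`** (large fields included; no
hypothesis (7.3.1)) on the torus model of record, every level `k`, every torus, `γ = min(a/(9d), ¼)` uniform in `k` and in the volume;
both printed forms of (7.3.2) coincide there (`u_k(b) = v_b`).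

statement-level skeleton of published theorems with citation tags; proofs where landed; nothing here is a claim about the Yang–Mills mass gap

PDF held: `paper:balaban1985-cmp97-bij-higgs-minimizers` (journal page = PDF page + 298).  Pages read (`lit read`, OCR text): p. 302–305
[PDF 4–7] ((2.4)–(2.6), (2.13)–(2.18)), p. 312–313 [PDF 14–15] ((4.5.1)–(4.5.4), (4.6.1)–(4.6.4)), p. 326 [PDF 28] ((7.3.1)–(7.3.2)).

CITATION HEADER (lean-in-tree rule).  Phase-2 file of the lit-balaban TYPED SKELETON (HOME `run/shared/lean/pub/lit-balaban/`), seat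
p33 gen 6 (unit `lit-balaban-p33-g6`; TAKING line HOME/STATUS.md 2026-08-21T10:38:53Z; owner r15, referee ref-5; free-target protocol
G.5-34(d), own block C1).  WHAT IS REPRODUCED = SKELETON row **C1.Eq7.3.1-7.3.2** (`typed p239582`, r15: *"NO printed proof — 'extension
of the proofs of [7]' = B4"*; HOME/GAPS.md G-C1-05), as a NEW PROVED MEMBER (kind «model-instance», partial: the pull-back backgrounds
`Q^{s*}_k v`, all `v`) next to p11's flat / pure-gauge members `BIJ85Ineq732Flat` (p253303).  Everything is used BY NAME: p11's `bondForm`,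
`cPhys`, `FlatIdx`, the covariant block-averaging inequality `BIJ85BlockAveragingIneqCov.sum_norm_qCovK_shift_sub_sq_le_cov` (p253348),
p31's group-valued pull-back of record `BIJ85Eq453GaugeField.qsstarGIter` ((4.5.3), p248815) at `G = U(1)`, r18's surface substitution
`BIJ85BlockAveragesTorus.surfMul` — nothing is re-declared.

THE PRINTED TEXT, verbatim (p. 326 [PDF 28]): *"let us assume that for the unit lattice field v, |v(∂p) − 1| ≤ e_k𝓅(e_k), (7.3.1) where
𝓅(e_k) = (1 + ln e_k^{−1})^𝓅. Then the stability estimate can be stated in two forms. For constants γ > 0, α > 0, M < ∞,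
⟨φ, Δ_k(u_k)φ⟩ ≥ γ Σ_{b∈T₁^{(k)}} |u_k(b)φ(b₊) − φ(b₋)|² − Me_k^{2−α} Σ_{x∈T₁^{(k)}} |φ(x)|². (7.3.2) The second form of the inequality
substitutes v_b for u_k(b) in the covariant derivative of φ. These inequalities can be proved by an extension of the proofs of [7]."*;
p. 312: *"(Q_k^{s*}v)_b = 1 if b is strictly contained in a k-block …, = v_c if … b belongs to the corridor of bonds connecting the two blocks
B^k(c₋) and B^k(c₊). (4.5.3)"*; p. 313: *"(u_k)_b = (Q^{s*}_kv)_b exp[−ie_kη(𝒟_k∂^*Q^{e*}_kf^{(k)})_b]. (4.5.4)"*.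

WHAT IS PROVED HERE (0 `sorry`, standard axioms; carriers exactly as in p11's `BIJ85Ineq732Flat`: `η`-lattice `Site P j`, unit lattice
`T₁^{(k)} = Site P (j+k)`, `j + k ≤ m + K`, `U(1)` fields read in `ℂ` by `toC`, `Dlin c u`, `QlinK u k` = `Q_k(u)` along the composite contours
(5.1.2)–(5.1.3), `Δ_k(u) = deltaOp (QlinK u k) a G`, `G` any right inverse of `D_u^*D_u + aQ_k^*Q_k`).
* §1 the background `qsstarGIter k v = Q^{s*}_k v`: its one-step factor IS r18's substitution (`qsstarG_eq_surfMul_one`); the `U(1)` reading of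
  (4.5.2) `BlockBonds.QsstarGroup`, `v = exp(ie_kB)`, `ηL^k = 1` (`toC_qsstarGIter_eq_QsstarGroup`).
* §2–§3 geometry: the iterated run transports (5.1.2)–(5.1.3) RETURN `v` (`lineIter_qsstarGIter`: the first printed form's `u_k(b)` IS `v_b`);
  the composite tree transports are trivial (`holCK_qsstarGIter`); **each straight run of `L^k` `η`-bonds from ANY site crosses exactly one
  `k`-face** (`toC_runProd_qsstarGIter`).
* §4 hence the HOLONOMY DEFECT of p11's covariant inequality VANISHES IDENTICALLY at `(u, W) = (Q^{s*}_k v, v)`, every `v`: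
  `Σ_{y,μ} |v(⟨y,y+e_μ⟩)(Q_k(u)φ)(y+e_μ) − (Q_k(u)φ)(y)|² ≤ 2(n²/N)·Σ_b |u_bφ(b₊) − φ(b₋)|²` (`sum_norm_qCovK_qsstarGIter_shift_sub_sq_le`).
* §5 the assembly of p. 326 / [7] abstracted once (`ineq732_of_blockAveraging`) and **(7.3.2) AT THE PULL-BACK BACKGROUND** (`ineq732_pullBack`):
  `min(a/(8d), Nc²/(4n²))·Σ_{b∈T₁^{(k)}} |v_bψ(b₊) − ψ(b₋)|² ≤ ⟨ψ, Δ_k(Q^{s*}_kv)ψ⟩` for EVERY `v`, `ψ`, `k`, torus (both printed forms); with the printed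
  `a_k` and the physical normalization **`γ = min(a/(9d), ¼)`, `M = 0`** (`ineq732_pullBack_phys`).
* §6 r15's typed `ScalarStabData.Claim73` INHABITED for the family of ALL pull-back data (`claim73_pullBack`; index `PullIdx d`: any torus of
  dimension `d`, any `k ≥ 1`, any `e_k`, ANY `v`; `|v(∂p) − 1|` the honest plaquette deviation), `γ = min(a/(9d), ¼)`, `α = 1`, `M = 0`.
HONEST SCOPE.  The paper's background is (4.5.4); this file treats its FIRST FACTOR `Q^{s*}_k v` (= (4.5.4) at `f^{(k)} = 0`): the whole
`Me_k^{2−α}`-term of (7.3.2) is due to the smoothing factor `exp[−ie_kη𝒟_k∂^*Q^{e*}_kf^{(k)}]` — at `Q^{s*}_k v` the loops of (2.10) at level `k`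
have trivial holonomy for EVERY `v` (no smallness needed); with the smoothing factor the defects are products of `O(L^k)` phases whose control
needs the regularity of `𝒟_k` ((7.2.2) = [B5] Prop. 1.2) — the unprinted *"extension of the proofs of [7]"* (G-C1-05), NOT claimed.  Nothing
printed is contradicted; no statement is weakened (the row's head stays with its owner).
-/

open scoped RealInnerProductSpace BigOperators
open Finset

namespace Literature.MathematicalPhysics.QuantumFieldTheory.BalabanImbrieJaffe1984to88.BIJ85Ineq732PullBack

open Literature.MathematicalPhysics.QuantumFieldTheory.Balaban1983to89
open BIJ88Sect3Statements (U1 toC cfg plaqVar norm_toC toC_one toC_mul)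
open BIJ88Sect3Rescaling (toC_injective_U1)
open BIJ85Sect1Model (HiggsField)
open B7SectAStatements (blockOfIter blockOfIter_zero blockOfIter_succ)
open BIJ85BlockAveragesTorus BIJ85BlockAveragesTorusK BIJ85ScalarPropagatorTorus BIJ85ScalarPropagatorTorusK
open BIJ85ScalarForm464
open BIJ85BlockAveragingIneq BIJ85BlockAveragingIneqCov BIJ85Ineq732Flat
open BIJ85Eq224Proof (torusBlockBondsIter mem_BsIter_iff blockOfIter_shift iter_L)
open BIJ85Eq453GaugeField (qsstarG qsstarG_apply qsstarGIter qsstarGIter_zero qsstarGIter_succ qsstarGIter_of_interior qsstarGIter_of_mem)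

noncomputable section

variable {P : Params} {j : ℕ}

/-! ## §0 Torus bookkeeping -/

/-- `y + e_μ ≠ y` on every torus of the series (`1 ≠ 0` in `ZMod (2L^{m+K−i})`). [folklore] -/
private theorem shift_ne_self' {i : ℕ} (y : Balaban1983to89.Site P i) (μ : Fin P.d) : y.shift μ ≠ y := by
  intro h
  have h1 := congrFun h μ
  simp only [Balaban1983to89.Site.shift, Function.update_self] at h1
  exact one_ne_zero (add_eq_left.1 h1)

/-! ## §1 The background: p31's pull-back `Q^{s*}_k v` (4.5.3) at `G = U(1)`; its one-step factor is r18's surface substitution -/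

/-- kernel: **p31's one-step pull-back (4.5.3) IS r18's surface substitution of (3.9) applied to the trivial field** (`v_{⟨B(b₋), μ⟩}` on the
bonds crossing a block face, `1` elsewhere; r18's `IsCross` ↔ p31's `blockOf b₊ ≠ blockOf b₋`; standing range). [cite: BalabanImbrieJaffe1985, (4.5.3) p.312] -/
theorem qsstarG_eq_surfMul_one {i : ℕ} (hi : i + 1 ≤ P.m + P.K) (v : GaugeField P (i + 1) U1) :
    qsstarG v = surfMul (1 : GaugeField P i U1) v := by
  funext b
  rw [qsstarG_apply]
  by_cases hb : IsCross b
  · rw [surfMul_of_isCross _ _ hb, blockOf_tgt_of_isCross hi hb, if_neg (shift_ne_self' _ _),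
      show (1 : GaugeField P i U1) b = 1 from rfl, one_mul]
    rfl
  · rw [surfMul_of_not_isCross _ _ hb, blockOf_tgt_of_not_isCross hi hb, if_pos rfl]
    rfl

/-- **The `U(1)` reading of (4.5.2)**: for `v = exp(ie_kB)` (4.5.1) in `U(1) ⊂ ℂ` and `ηL^k = 1`, the record's typed `(Q_k^{s*}v)_b =
exp((ie_kηQ_k^{s*}B)_b)` (`BlockBonds.QsstarGroup` over the k-fold torus geometry) agrees bondwise with p31's `Q^{s*}_k v` read in `ℂ` (via r15's
`eq453_interior`/`eq453_corridor`; `Circle` twin: p31's `expField_QsstarIter_eq_qsstarGIter`). [cite: BalabanImbrieJaffe1985, (4.5.2) p.312] -/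
theorem toC_qsstarGIter_eq_QsstarGroup {k : ℕ} (hk : j + k ≤ P.m + P.K) {e η : ℝ} (hη : η * (P.L : ℝ) ^ k = 1)
    (B : PBond P (j + k) → ℝ) (v : GaugeField P (j + k) U1)
    (hv : ∀ c, toC (v c) = Complex.exp (Complex.I * ((e : ℂ) * (B c : ℂ)))) (b : PBond P j) :
    toC (qsstarGIter k v b) = (torusBlockBondsIter P j k).QsstarGroup e η B b := by
  have hη' : η * ((torusBlockBondsIter P j k).L : ℝ) = 1 := by
    rw [iter_L]; push_cast; exact hη
  by_cases h : blockOfIter k b.tgt = blockOfIter k b.src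
  · rw [qsstarGIter_of_interior hk v h.symm, toC_one, (torusBlockBondsIter P j k).eq453_interior e η B]
    exact h.symm
  · have hmem : b ∈ (torusBlockBondsIter P j k).Bs ⟨blockOfIter k b.src, b.dir⟩ := by
      rw [mem_BsIter_iff]
      exact ⟨rfl, (blockOfIter_shift k hk b.src b.dir).resolve_left h⟩
    rw [qsstarGIter_of_mem hk v hmem, hv, (torusBlockBondsIter P j k).eq453_corridor e η hη' B hmem]
    rfl

/-! ## §2 Run transports (2.5) along straight runs: composition, and the iterates `u^{(i)}` of the pull-back -/

/-- kernel: runs compose, `u(run_{x,a+b}) = u(run_{x,a})·u(run_{x+ae_μ,b})` (the ordered product (2.5)). [cite: BalabanImbrieJaffe1985, (2.5) p.302] -/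
theorem runProd_add (U : GaugeField P j U1) (x : Balaban1983to89.Site P j) (μ : Fin P.d) (a : ℕ) :
    ∀ b : ℕ, runProd U x μ (a + b) = runProd U x μ a * runProd U (runSite x μ a) μ b
  | 0 => by rw [add_zero, runProd, mul_one]
  | b + 1 => by
    rw [← add_assoc, runProd, runProd_add U x μ a b, runProd, mul_assoc]
    congr 2
    show U ⟨runSite x μ (a + b), μ⟩ = U ⟨runSite (runSite x μ a) μ b, μ⟩
    rw [runSite_add]

/-- kernel: a run of `n·s` bonds is the ordered product of `s` consecutive runs of `n` bonds (read in `ℂ`). [cite: BalabanImbrieJaffe1985, (2.5) p.302] -/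
theorem toC_runProd_mul (U : GaugeField P j U1) (x : Balaban1983to89.Site P j) (μ : Fin P.d) (n : ℕ) :
    ∀ s : ℕ, toC (runProd U x μ (n * s)) = ∏ i ∈ range s, toC (runProd U (runSite x μ (n * i)) μ n)
  | 0 => by rw [mul_zero, runProd, toC_one, prod_range_zero]
  | s + 1 => by rw [mul_add, mul_one, runProd_add, toC_mul, toC_runProd_mul U x μ n s, prod_range_succ]

/-- kernel: at the trivial field the run transport (2.10) is `1`. [cite: BalabanImbrieJaffe1985, (2.10) p.303] -/
theorem runC_one {i : ℕ} (x : Balaban1983to89.Site P i) (μ : Fin P.d) : runC (1 : GaugeField P i U1) x μ = 1 :=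
  prod_eq_one fun t _ => by rw [show (1 : GaugeField P i U1) (runBond x μ t) = 1 from rfl, toC_one]

/-- kernel: **the `L`-lattice transports of the one-level pull-back RETURN the coarse field**, `(Q^{s*}v)(Γ_{yy′}) = v_{⟨y,y′⟩}` (the run of `L`
bonds from the corner `y` crosses the face into `B(y′)` exactly once; r18's `runC_surfMul`). [cite: BalabanImbrieJaffe1985, (4.5.3) p.312] -/
theorem lineU_surfMul_one {i : ℕ} (hi : i + 1 ≤ P.m + P.K) (v : GaugeField P (i + 1) U1) :
    lineU (surfMul (1 : GaugeField P i U1) v) = v := by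
  funext c
  apply toC_injective_U1
  rw [toC_lineU, runC_surfMul hi, runC_one, one_mul, blockOf_corner hi]

/-- **The iterated run transports (5.1.2)–(5.1.3) of the pull-back return `v`**: `lineIter (Q^{s*}_k v) k = v` — the transport of `Q^{s*}_k v`
along the unit bond `b` of `T₁^{(k)}` is `v_b`; hence the FIRST printed form of (7.3.2) (`u_k(b)`, [BalabanImbrieJaffe1988] (4.4) *"ū_{k,b} =
u_k(⟨b₋, b₊⟩)"*) and the SECOND (`v_b`) coincide at this background (standing range). [cite: BalabanImbrieJaffe1985, (7.3.2) p.326] -/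
theorem lineIter_qsstarGIter : ∀ (k : ℕ), j + k ≤ P.m + P.K → ∀ v : GaugeField P (j + k) U1, lineIter (qsstarGIter k v) k = v
  | 0, _, _ => rfl
  | k + 1, hk, v => by
    rw [lineIter_succ, qsstarGIter_succ, lineIter_qsstarGIter k (by omega) (qsstarG v), qsstarG_eq_surfMul_one (by omega),
      lineU_surfMul_one (by omega)]

/-! ## §3 The composite tree transports are trivial; each run of `L^k` bonds crosses exactly one `k`-face -/

/-- **The composite tree transports of the pull-back are trivial**, `(Q^{s*}_kv)(Γ^{(k)}_{x_k,x}) = 1` for every `x`: every bond of the composite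
contour (5.1.3) stays inside its block, where (4.5.3) gives `1` (r18's `holC_surfMul`; standing range). [cite: BalabanImbrieJaffe1985, (5.1.2)–(5.1.3) p.313] -/
theorem holCK_qsstarGIter : ∀ (k : ℕ), j + k ≤ P.m + P.K → ∀ (v : GaugeField P (j + k) U1) (x : Balaban1983to89.Site P j),
    holCK (qsstarGIter k v) k x = 1
  | 0, _, _, _ => rfl
  | k + 1, hk, v, x => by
    rw [holCK_succ, qsstarGIter_succ, lineIter_qsstarGIter k (by omega) (qsstarG v), holCK_qsstarGIter k (by omega) (qsstarG v) x,
      mul_one, qsstarG_eq_surfMul_one (by omega), holC_surfMul (by omega), holC_of_deltaAx (by omega) deltaAx_one]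

/-- **Each straight run of `L^k` `η`-bonds crosses exactly one `k`-face**: for EVERY starting point `x ∈ T^{(j)}` (not only corners),
`Π_{t<L^k} (Q^{s*}_kv)(⟨x + te_μ, x + (t+1)e_μ⟩) = v(⟨x_k, x_k + e_μ⟩)` (induction on `k`: a run of `L^k·L` bonds is `L` consecutive runs of `L^k` bonds
whose `k`-fold block points form the one-level run from `x_k`, p11's `blkIter_runSite`; then r18's `runC_surfMul`). [cite: BalabanImbrieJaffe1985, (4.5.3) p.312] -/
theorem toC_runProd_qsstarGIter : ∀ (k : ℕ), j + k ≤ P.m + P.K → ∀ (v : GaugeField P (j + k) U1) (x : Balaban1983to89.Site P j) (μ : Fin P.d),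
    toC (runProd (qsstarGIter k v) x μ (P.L ^ k)) = toC (v ⟨blkIter k x, μ⟩)
  | 0, _, v, x, μ => by
    show toC (runProd v x μ 1) = toC (v ⟨x, μ⟩)
    have h1 : runProd v x μ 1 = 1 * v (runBond x μ 0) := rfl
    rw [h1, one_mul]
    show toC (v ⟨runSite x μ 0, μ⟩) = toC (v ⟨x, μ⟩)
    rw [runSite_zero]
  | k + 1, hk, v, x, μ => by
    have hk' : j + k ≤ P.m + P.K := by omega
    rw [pow_succ, qsstarGIter_succ, toC_runProd_mul]
    have e : ∀ s ∈ range P.L, toC (runProd (qsstarGIter k (qsstarG v)) (runSite x μ (P.L ^ k * s)) μ (P.L ^ k))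
        = toC ((qsstarG v) (runBond (blkIter k x) μ s)) := fun s _ => by
      rw [toC_runProd_qsstarGIter k hk' (qsstarG v) (runSite x μ (P.L ^ k * s)) μ, blkIter_runSite μ k hk' x s]
      rfl
    rw [prod_congr rfl e]
    show runC (qsstarG v) (blkIter k x) μ = toC (v ⟨blkIter (k + 1) x, μ⟩)
    rw [qsstarG_eq_surfMul_one (by omega), runC_surfMul (by omega), runC_one, one_mul, blkIter_succ]

/-! ## §4 The holonomy defect of the covariant block-averaging inequality VANISHES at `(u, W) = (Q^{s*}_k v, v)` -/

/-- **THE BLOCK-AVERAGING INEQUALITY AT THE PULL-BACK BACKGROUND, EVERY `v`**: for every unit-lattice `U(1)` field `v`, every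
`φ : T_η → ℂ`, `j + k ≤ m + K`: `Σ_{y,μ} |v(⟨y,y+e_μ⟩)(Q_k(u)φ)(y+e_μ) − (Q_k(u)φ)(y)|² ≤ 2(n²/N)·Σ_{b⊂T_η} |u_bφ(b₊) − φ(b₋)|²`, `u = Q^{s*}_kv`,
`n = L^k`, `N = L^{kd}` — p11's `sum_norm_qCovK_shift_sub_sq_le_cov` in which EVERY holonomy defect `ρ_μ(x) = u(Γ^{(k)}_x)^{−1}·v·u(Γ^{(k)}_{x+ne_μ})·
u(run_{x,μ,n})^{−1}` equals `1⁻¹·v·1·v⁻¹ = 1`: the loops of (2.10) at level `k` have trivial holonomy, whatever `v` is. [cite: BalabanImbrieJaffe1985, (7.3.2) p.326] -/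
theorem sum_norm_qCovK_qsstarGIter_shift_sub_sq_le {k : ℕ} (hk : j + k ≤ P.m + P.K) (v : GaugeField P (j + k) U1) (φ : HiggsField P j) :
    ∑ y : Balaban1983to89.Site P (j + k), ∑ μ : Fin P.d,
        ‖toC (v ⟨y, μ⟩) * qCovK (qsstarGIter k v) k φ (y.shift μ) - qCovK (qsstarGIter k v) k φ y‖ ^ 2
      ≤ 2 * (((P.L : ℝ) ^ k) ^ 2 / (P.L : ℝ) ^ (k * P.d))
          * ∑ b : PBond P j, ‖toC (qsstarGIter k v b) * φ b.tgt - φ b.src‖ ^ 2 := by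
  have h := sum_norm_qCovK_shift_sub_sq_le_cov hk (qsstarGIter k v) v φ
  have h0 : ∑ x : Balaban1983to89.Site P j, ∑ μ : Fin P.d,
      ‖(holCK (qsstarGIter k v) k x)⁻¹ * toC (v ⟨blkIter k x, μ⟩) * holCK (qsstarGIter k v) k (runSite x μ (P.L ^ k))
          * (toC (runProd (qsstarGIter k v) x μ (P.L ^ k)))⁻¹ - 1‖ ^ 2 * ‖φ (runSite x μ (P.L ^ k))‖ ^ 2 = 0 := by
    refine sum_eq_zero fun x _ => sum_eq_zero fun μ _ => ?_
    rw [holCK_qsstarGIter k hk, holCK_qsstarGIter k hk, toC_runProd_qsstarGIter k hk, inv_one, one_mul, mul_one,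
      mul_inv_cancel₀ (toC_ne_zero _), sub_self, norm_zero, zero_pow two_ne_zero, zero_mul]
  rw [h0, mul_zero, add_zero] at h
  exact h

/-! ## §5 (7.3.2) AT THE PULL-BACK BACKGROUND — the assembly of p. 326 / [7], abstracted once, then instantiated -/

/-- kernel: `‖D_uφ‖² = c²Σ_b|u_bφ(b₊) − φ(b₋)|²` for EVERY background (gen 2's `norm_Dlin_sq`). [cite: BalabanImbrieJaffe1985, (4.6.3) p.313] -/
theorem norm_Dlin_sq' (c : ℝ) (U : GaugeField P j U1) (φ : FineSp P j) :
    ‖Dlin c U φ‖ ^ 2 = c ^ 2 * ∑ b : PBond P j, ‖toC (U b) * φ b.tgt - φ b.src‖ ^ 2 := by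
  rw [norm_Dlin_sq, mul_sum]
  refine sum_congr rfl fun b _ => ?_
  rw [norm_mul, mul_pow, Complex.norm_real, Real.norm_eq_abs, sq_abs]

/-- **THE ASSEMBLY OF (7.3.2) (the elementary route of [7] = B4 Prop. 3.1′, as in p11's `ineq732_flat`), ABSTRACTED**: if the background `u`
and the unit-lattice field `W` obey `Σ_{y,μ} |W(⟨y,y+e_μ⟩)(Q_k(u)φ)(y+e_μ) − (Q_k(u)φ)(y)|² ≤ κ·Σ_b |u_bφ(b₊) − φ(b₋)|²` for every `φ` (`κ > 0`), then
for `a > 0`, `c ≠ 0`, `G` any right inverse of `D_u^*D_u + aQ_k(u)^*Q_k(u)`, every `ψ`: `min(a/(8d), c²/(2κ))·E_W(ψ) ≤ ⟨ψ, Δ_k(u)ψ⟩` (via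
`⟨ψ, Δ_kψ⟩ = a‖Q_kφ_k − ψ‖² + ‖D_uφ_k‖²`, `E_W(ψ) ≤ 8d‖ψ − Q_kφ_k‖² + 2(κ/c²)‖D_uφ_k‖²`). [cite: BalabanImbrieJaffe1985, (7.3.2) p.326] -/
theorem ineq732_of_blockAveraging {k : ℕ} {c : ℝ} (hc : c ≠ 0) {a : ℝ} (ha : 0 < a) (U : GaugeField P j U1)
    (W : GaugeField P (j + k) U1) {κ : ℝ} (hκ : 0 < κ)
    (hBA : ∀ φ : HiggsField P j,
      ∑ y : Balaban1983to89.Site P (j + k), ∑ μ : Fin P.d, ‖toC (W ⟨y, μ⟩) * qCovK U k φ (y.shift μ) - qCovK U k φ y‖ ^ 2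
        ≤ κ * ∑ b : PBond P j, ‖toC (U b) * φ b.tgt - φ b.src‖ ^ 2)
    {G : FineSp P j →ₗ[ℝ] FineSp P j} (hG : ∀ φ, opT (Dlin c U) (QlinK U k) a (G φ) = φ) (ψ : CoarseSpK P j k) :
    min (a / (8 * P.d)) (c ^ 2 / (2 * κ)) * bondForm W ψ ≤ ⟪ψ, deltaOp (QlinK U k) a G ψ⟫ := by
  set φk : FineSp P j := phiCl (QlinK U k) a G ψ with hφk
  set X : ℝ := ‖QlinK U k φk - ψ‖ ^ 2 with hX
  set Y : ℝ := ‖Dlin c U φk‖ ^ 2 with hY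
  set γ : ℝ := min (a / (8 * P.d)) (c ^ 2 / (2 * κ)) with hγ
  have hd : (0 : ℝ) < P.d := Nat.cast_pos.2 P.hd
  have hc2 : 0 < c ^ 2 := by positivity
  have hX0 : 0 ≤ X := by positivity
  have hY0 : 0 ≤ Y := by positivity
  have hγ0 : 0 ≤ γ := le_min (by positivity) (by positivity)
  have hΔ : ⟪ψ, deltaOp (QlinK U k) a G ψ⟫ = a * X + Y := inner_deltaOp_eq hG ψ
  have hsplit : bondForm W ψ ≤ 2 * bondForm W (ψ - QlinK U k φk) + 2 * bondForm W (QlinK U k φk) := by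
    have h := bondForm_add_le W (ψ - QlinK U k φk) (QlinK U k φk)
    rwa [sub_add_cancel] at h
  have h1 : bondForm W (ψ - QlinK U k φk) ≤ 4 * P.d * X := by
    rw [hX, ← norm_neg, neg_sub]
    exact bondForm_le _ _
  have h2 : bondForm W (QlinK U k φk) ≤ κ / c ^ 2 * Y := by
    have h := hBA (WithLp.ofLp φk)
    have hS : ∑ b : PBond P j, ‖toC (U b) * φk b.tgt - φk b.src‖ ^ 2 = Y / c ^ 2 := by
      rw [hY, norm_Dlin_sq', mul_div_cancel_left₀ _ hc2.ne']
    have hL : bondForm W (QlinK U k φk) = ∑ y : Balaban1983to89.Site P (j + k), ∑ μ : Fin P.d,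
        ‖toC (W ⟨y, μ⟩) * qCovK U k (WithLp.ofLp φk) (y.shift μ) - qCovK U k (WithLp.ofLp φk) y‖ ^ 2 := by
      unfold bondForm; rw [sum_bond_eq]; rfl
    rw [hL]
    refine h.trans (le_of_eq ?_)
    rw [show (∑ b : PBond P j, ‖toC (U b) * (WithLp.ofLp φk) b.tgt - (WithLp.ofLp φk) b.src‖ ^ 2) = Y / c ^ 2 from hS]
    field_simp
  have hγ1 : γ * (8 * P.d) ≤ a := by
    have := min_le_left (a / (8 * P.d)) (c ^ 2 / (2 * κ))
    rwa [le_div_iff₀ (by positivity)] at this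
  have hγ2 : γ * (2 * (κ / c ^ 2)) ≤ 1 := by
    have h := min_le_right (a / (8 * P.d)) (c ^ 2 / (2 * κ))
    calc γ * (2 * (κ / c ^ 2)) ≤ c ^ 2 / (2 * κ) * (2 * (κ / c ^ 2)) :=
          mul_le_mul_of_nonneg_right h (by positivity)
      _ = 1 := by field_simp
  calc γ * bondForm W ψ
      ≤ γ * (2 * (4 * P.d * X) + 2 * (κ / c ^ 2 * Y)) :=
        mul_le_mul_of_nonneg_left (hsplit.trans (by linarith)) hγ0
    _ = γ * (8 * P.d) * X + γ * (2 * (κ / c ^ 2)) * Y := by ring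
    _ ≤ a * X + 1 * Y := add_le_add (mul_le_mul_of_nonneg_right hγ1 hX0) (mul_le_mul_of_nonneg_right hγ2 hY0)
    _ = _ := by rw [hΔ, one_mul]

/-- **(7.3.2) AT THE PULL-BACK BACKGROUND `u = Q^{s*}_k v`, EVERY `v`, EVERY LEVEL `k`, EVERY TORUS** (second printed form, `v_b` in the
covariant derivative of `ψ`): for `j + k ≤ m + K`, `a > 0`, `c ≠ 0`, `G` any right inverse of `D_u^*D_u + aQ_k^*Q_k` at `u = Q^{s*}_k v` and every `ψ`,
`min(a/(8d), Nc²/(4n²))·Σ_{b∈T₁^{(k)}} |v_bψ(b₊) − ψ(b₋)|² ≤ ⟨ψ, Δ_k(Q^{s*}_kv)ψ⟩` (`n = L^k`, `N = L^{kd}`) — NO negative mass term, NO hypothesis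
(7.3.1) on `v`. [cite: BalabanImbrieJaffe1985, (7.3.2) p.326] -/
theorem ineq732_pullBack {k : ℕ} (hk : j + k ≤ P.m + P.K) {c : ℝ} (hc : c ≠ 0) {a : ℝ} (ha : 0 < a)
    (v : GaugeField P (j + k) U1) {G : FineSp P j →ₗ[ℝ] FineSp P j}
    (hG : ∀ φ, opT (Dlin c (qsstarGIter k v)) (QlinK (qsstarGIter k v) k) a (G φ) = φ) (ψ : CoarseSpK P j k) :
    min (a / (8 * P.d)) ((P.L : ℝ) ^ (k * P.d) * c ^ 2 / (4 * ((P.L : ℝ) ^ k) ^ 2)) * bondForm v ψ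
      ≤ ⟪ψ, deltaOp (QlinK (qsstarGIter k v) k) a G ψ⟫ := by
  have hLpos : (0 : ℝ) < P.L := Nat.cast_pos.2 P.L_pos
  have h := ineq732_of_blockAveraging (k := k) hc ha (qsstarGIter k v) v
    (κ := 2 * (((P.L : ℝ) ^ k) ^ 2 / (P.L : ℝ) ^ (k * P.d))) (by positivity)
    (fun φ => sum_norm_qCovK_qsstarGIter_shift_sub_sq_le hk v φ) hG ψ
  have e : c ^ 2 / (2 * (2 * (((P.L : ℝ) ^ k) ^ 2 / (P.L : ℝ) ^ (k * P.d))))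
      = (P.L : ℝ) ^ (k * P.d) * c ^ 2 / (4 * ((P.L : ℝ) ^ k) ^ 2) := by
    field_simp
    ring
  rwa [e] at h

/-- **(7.3.2), FIRST printed form, at the pull-back background**: with `u_k(b)` := the transport of `u = Q^{s*}_k v` along the unit bond `b`
(`lineIter u k`, `= v` here), `min(a/(8d), Nc²/(4n²))·Σ_b |u_k(b)ψ(b₊) − ψ(b₋)|² ≤ ⟨ψ, Δ_k(u)ψ⟩`. [cite: BalabanImbrieJaffe1985, (7.3.2) p.326] -/
theorem ineq732_pullBack_first {k : ℕ} (hk : j + k ≤ P.m + P.K) {c : ℝ} (hc : c ≠ 0) {a : ℝ} (ha : 0 < a)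
    (v : GaugeField P (j + k) U1) {G : FineSp P j →ₗ[ℝ] FineSp P j}
    (hG : ∀ φ, opT (Dlin c (qsstarGIter k v)) (QlinK (qsstarGIter k v) k) a (G φ) = φ) (ψ : CoarseSpK P j k) :
    min (a / (8 * P.d)) ((P.L : ℝ) ^ (k * P.d) * c ^ 2 / (4 * ((P.L : ℝ) ^ k) ^ 2)) * bondForm (lineIter (qsstarGIter k v) k) ψ
      ≤ ⟪ψ, deltaOp (QlinK (qsstarGIter k v) k) a G ψ⟫ := by
  rw [lineIter_qsstarGIter k hk]
  exact ineq732_pullBack hk hc ha v hG ψ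

/-- kernel: at the physical normalization `c² = η^{d−2} = n²/N` the constant of `ineq732_pullBack` is `Nc²/(4n²) = ¼`. [cite: BalabanImbrieJaffe1985, (7.3.2) p.326] -/
theorem cPhys_const_four (P : Params) (k : ℕ) :
    (P.L : ℝ) ^ (k * P.d) * cPhys P k ^ 2 / (4 * ((P.L : ℝ) ^ k) ^ 2) = 1 / 4 := by
  have h1 : (0 : ℝ) < (P.L : ℝ) ^ (k * P.d) := pow_pos (Nat.cast_pos.2 P.L_pos) _
  have h2 : (0 : ℝ) < ((P.L : ℝ) ^ k) ^ 2 := pow_pos (pow_pos (Nat.cast_pos.2 P.L_pos) _) _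
  rw [cPhys_sq, mul_div_assoc', mul_div_cancel_left₀ _ h1.ne', div_eq_iff (by positivity)]
  ring

/-- **(7.3.2) at the pull-back background with the PRINTED `a_k` and the physical normalization — `γ = min(a/(9d), ¼)` UNIFORM IN `k`, IN THE
VOLUME AND IN `v`, `M = 0`**: `min(a/(9d), ¼)·Σ_{b∈T₁^{(k)}} |v_bψ(b₊) − ψ(b₋)|² ≤ ⟨ψ, Δ_k(Q^{s*}_kv)ψ⟩` for `1 ≤ k`, `j + k ≤ m + K`, `a > 0`, every `v`, `ψ`
(`ineq732_pullBack` + `cPhys_const_four` + p11's `a_k ≥ 8a/9`). [cite: BalabanImbrieJaffe1985, (7.3.2) p.326] -/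
theorem ineq732_pullBack_phys {k : ℕ} (hk1 : 1 ≤ k) (hk : j + k ≤ P.m + P.K) {a : ℝ} (ha : 0 < a)
    (v : GaugeField P (j + k) U1) {G : FineSp P j →ₗ[ℝ] FineSp P j}
    (hG : ∀ φ, opT (Dlin (cPhys P k) (qsstarGIter k v)) (QlinK (qsstarGIter k v) k) (BIJ85Sect4Statements.aK a P.L k) (G φ) = φ)
    (ψ : CoarseSpK P j k) :
    min (a / (9 * P.d)) (1 / 4) * bondForm v ψ
      ≤ ⟪ψ, deltaOp (QlinK (qsstarGIter k v) k) (BIJ85Sect4Statements.aK a P.L k) G ψ⟫ := by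
  have hL : (1 : ℝ) < P.L := by linarith [three_le_L P]
  have haK := (BIJ85CoefficientAk464.aK_pos_le ha hL hk1).1
  have h := ineq732_pullBack hk (cPhys_pos P k).ne' haK v hG ψ
  rw [cPhys_const_four] at h
  refine le_trans (mul_le_mul_of_nonneg_right ?_ (bondForm_nonneg _ _)) h
  have hd : (0 : ℝ) < P.d := Nat.cast_pos.2 P.hd
  refine min_le_min ?_ le_rfl
  rw [div_le_div_iff₀ (by positivity) (by positivity)]
  nlinarith [aK_ge_eight_ninths P ha.le hk1]

/-! ## §6 r15's `Claim73` for the family of ALL pull-back data (every `v`, every `e_k`) -/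

/-- Index of the PULL-BACK FAMILY of Sect. 7.3 data: p11's `FlatIdx` (any torus of dimension `d`, levels `j`, `k ≥ 1` in the standing range),
ANY value recorded as `e_k`, ANY unit-lattice `U(1)` field `v` on the bonds of `T₁^{(k)}`. [cite: BalabanImbrieJaffe1985, (7.3.2) p.326] -/
structure PullIdx (d : ℕ) where
  base : FlatIdx d
  ek : ℝ
  v : GaugeField base.P (base.j + base.k) U1

/-- `G_k(Q^{s*}_kv) = [−Δ_{Q^{s*}_kv} + a_kQ_k^*Q_k]^{−1}`: THE inverse of (4.6.2) at the background `Q^{s*}_k v` (exists for every background,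
gen 3's `exists_GK`; chosen by `Classical.choose`). [cite: BalabanImbrieJaffe1985, (4.6.2) p.313] -/
def pullG {d : ℕ} (a : ℝ) (ha : 0 < a) (i : PullIdx d) : FineSp i.base.P i.base.j →ₗ[ℝ] FineSp i.base.P i.base.j :=
  Classical.choose (exists_GK i.base.hk (cPhys_pos i.base.P i.base.k).ne' (i.base.aK_pos ha) (qsstarGIter i.base.k i.v))

/-- kernel: `pullG` is a right inverse of `D_u^*D_u + a_kQ_k(u)^*Q_k(u)` at `u = Q^{s*}_k v`. [cite: BalabanImbrieJaffe1985, (4.6.2) p.313] -/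
theorem pullG_spec {d : ℕ} (a : ℝ) (ha : 0 < a) (i : PullIdx d) (φ : FineSp i.base.P i.base.j) :
    opT (Dlin (cPhys i.base.P i.base.k) (qsstarGIter i.base.k i.v)) (QlinK (qsstarGIter i.base.k i.v) i.base.k)
      (BIJ85Sect4Statements.aK a i.base.P.L i.base.k) (pullG a ha i φ) = φ :=
  (Classical.choose_spec (exists_GK i.base.hk (cPhys_pos i.base.P i.base.k).ne' (i.base.aK_pos ha)
    (qsstarGIter i.base.k i.v))).1 φ

/-- **The pull-back MODEL INSTANCE of r15's Sect. 7.3 carrier** `ScalarStabData` at an index `i`: plaquettes/bonds/sites of `T₁^{(k)}`, `ψ ∈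
ℓ²(T₁^{(k)})`, the HONEST plaquette deviation `|v(∂p) − 1|` (`BIJ88Sect3Statements.plaqVar`), the bond term `|v_bψ(b₊) − ψ(b₋)|²` (both printed
forms), `|ψ(x)|²`, `⟨ψ, Δ_k(Q^{s*}_kv)ψ⟩` with the printed `a_k`, physical normalization, `G_k = pullG`; `e_k` = the index's value. [cite: BalabanImbrieJaffe1985, (7.3.2) p.326] -/
def pullStabData {d : ℕ} (a : ℝ) (ha : 0 < a) (i : PullIdx d) : BIJ85Sect7Statements.ScalarStabData where
  Plaq := Balaban1983to89.Plaq i.base.P (i.base.j + i.base.k)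
  Bond := PBond i.base.P (i.base.j + i.base.k)
  Site := Balaban1983to89.Site i.base.P (i.base.j + i.base.k)
  Scalar := CoarseSpK i.base.P i.base.j i.base.k
  ek := i.ek
  plaqDev := fun p => ‖plaqVar (cfg i.v) p - 1‖
  covDiffSq := fun ψ b => ‖toC (i.v b) * ψ b.tgt - ψ b.src‖ ^ 2
  absSq := fun ψ x => ‖ψ x‖ ^ 2
  deltaForm := fun ψ =>
    ⟪ψ, deltaOp (QlinK (qsstarGIter i.base.k i.v) i.base.k) (BIJ85Sect4Statements.aK a i.base.P.L i.base.k) (pullG a ha i) ψ⟫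

/-- **r15's typed (7.3.2) `ScalarStabData.Ineq732 γ α M` HOLDS for every pull-back datum**, `γ = min(a/(9d), ¼)`, `α = 1`, `M = 0` — every `v`,
no use of (7.3.1). [cite: BalabanImbrieJaffe1985, (7.3.2) p.326] -/
theorem ineq732_pullStabData {d : ℕ} (a : ℝ) (ha : 0 < a) (i : PullIdx d) :
    (pullStabData a ha i).Ineq732 (min (a / (9 * d)) (1 / 4)) 1 0 := by
  intro ψ
  dsimp only [pullStabData] at ψ ⊢
  have hd' : (d : ℝ) = (i.base.P.d : ℝ) := by rw [i.base.hd]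
  rw [zero_mul, zero_mul, sub_zero, hd']
  exact ineq732_pullBack_phys i.base.hk1 i.base.hk ha i.v (pullG_spec a ha i) ψ

/-- kernel: the sub-family `v = 1`, `e_k = 1` satisfies (7.3.1) — the instance below is not vacuous on the hypothesis side. [cite: BalabanImbrieJaffe1985, (7.3.1) p.326] -/
theorem hyp731_pullBack_one {d : ℕ} (a : ℝ) (ha : 0 < a) (b : FlatIdx d) (pexp : ℝ) :
    (pullStabData a ha ⟨b, 1, 1⟩).Hyp731 pexp := by
  intro p
  have e : plaqVar (cfg (1 : GaugeField b.P (b.j + b.k) U1)) p = 1 := by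
    simp [plaqVar, cfg, show ∀ c, (1 : GaugeField b.P (b.j + b.k) U1) c = 1 from fun _ => rfl, toC_one]
  show ‖plaqVar (cfg (1 : GaugeField b.P (b.j + b.k) U1)) p - 1‖ ≤ 1 * (1 + Real.log 1⁻¹) ^ pexp
  simp [e]

/-- **r15's typed claim of Sect. 7.3 `ScalarStabData.Claim73 𝓅 fam` ("for constants γ > 0, α > 0, M < ∞, (7.3.1) ⇒ (7.3.2)") PROVED FOR THE
FAMILY OF ALL PULL-BACK DATA** over `PullIdx d` (every torus, every `k ≥ 1`, EVERY `v`, large fields included): `γ = min(a/(9d), ¼)`, `α = 1`,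
`M = 0`.  HONEST SCOPE: background = `Q^{s*}_k v` = (4.5.4) at `f^{(k)} = 0`; the smoothing factor of (4.5.4) is the unprinted *"extension of the
proofs of [7]"* (G-C1-05). [cite: BalabanImbrieJaffe1985, (7.3.1)–(7.3.2) p.326] -/
theorem claim73_pullBack {d : ℕ} (hd : 0 < d) (a : ℝ) (ha : 0 < a) (pexp : ℝ) :
    BIJ85Sect7Statements.ScalarStabData.Claim73 pexp (pullStabData (d := d) a ha) :=
  ⟨min (a / (9 * d)) (1 / 4), 1, 0, lt_min (by positivity) (by norm_num), one_pos,
    fun i _ => ineq732_pullStabData a ha i⟩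

end

end Literature.MathematicalPhysics.QuantumFieldTheory.BalabanImbrieJaffe1984to88.BIJ85Ineq732PullBack
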